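import Summits.BirchSwinnertonDyer.BirchSwinnertonDyer.Theorems.Rank1ResidualIntModelReduction
import Summits.BirchSwinnertonDyer.Rank1Residual.X11b.CertificateRecordsGeneric
import Literature.NumberTheory.EllipticCurves.ComplexMultiplicationLocalFactorsAux
import Literature.NumberTheory.EllipticCurves.PointCountEulerCriterion
import HarnessLib

/-!
# Small-image strand (O8 / N2–N3 axis): `irr(5)` by a FROBENIUS CERTIFICATE in the kernel for the non-CM index-zero pairs of the Ш-census rule V16 — part B (`8092a1` · `8100e1` · `8100f1` · `11552j1`)

HONEST FRAMING (cell `b2b-bsdres`, run/shared/lean/b2b/bsd-rank1-residual/, verbatim in every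
file): the goal of the cell is to DELETE the COMBINATION-SHAPED residual classes of the
Birch–Swinnerton-Dyer formula for ALL analytic-rank `≤ 1` elliptic curves over `ℚ` — "full BSD
formula for every rank `≤ 1` curve in class `C`" assembled STRICTLY from published theorems — so
that the rank-`≤ 1` remainder becomes exactly the CONSTRUCTION-SHAPED classes, which are TYPED
(missing-input `Prop`s), NOT attempted. This is not "finishing BSD". CLASS-CLOSURE lane, seat
cc-typer-1 (typer of record for the non-surjective-image strand O8 and the joint small-image axis
N2/N3), generation 13: PER-PAIR RECORDS (model definitions + theorems; no named fact, no axiom, no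
`sorry`); nothing is booked by this file; no label and no census number moves; every open class stays
open. Parts `A`, `C`, `D` are the sibling files (17 records in all; the parts are independent — the two
generic helpers are repeated as `private` declarations in each, suffixed by the part letter).

## What this file records

The Ш-census seat `b2b-bsdres-sha-2` (GEN 15, rule V16; `HOME/b2b-bsdres-sha-2/gen15/x411/V16.json`,
`METHODS-x411.md` §3b) closes 17 never-eligible NON-CM pairs `(E, 5)` whose mod-`5` image is NOT
surjective (ecdata image codes `5S4`, `5Ns`, `5Nn`) through the GENERIC Matar–Nekovář consumer
`Literature.….Rank1Residual.Typed.bsdp_of_matarNekovar_of_not_dvd_index` (p199938; Matar–Nekovář, JTNB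
**31** (2019) Thm. 6.7 (1): IRREDUCIBILITY of `E[p]`, not surjectivity, is the image input), with the
Heegner-index binder from a two-engine height-ratio certificate and the binder `hirr` from Mazur's
Frobenius criterion at a witness prime found by two implementations (`frobirr.py` naive count; PARI
`ellap`, kit job j135765; 1224/1224 agree). That seat asked (INBOX 2026-08-21T17:39Z, "x1b /
cc-typer") for the irreducibility input to be made a KERNEL THEOREM per pair, exactly as
`X12/FrobeniusIrrRecords.lean` (harvest-1 g13) did for `7569a1 @29` / `15129a1 @41`. These files do
that with the cell's integer-model toolkit (`IntModel.hasIrreducibleModPGaloisRep_of_intModel_of_noroot`,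
`Rank1ResidualIntModelReduction.lean`, x11c): for the globally minimal `W` with integral model `E₀`, a
good prime `ℓ ≠ p` with `#(E₀ mod ℓ)(𝔽_ℓ) = n` such that `X² − (ℓ + 1 − n)X + ℓ` has NO root in `ℤ/p`
forces `E[p]` to be irreducible (a `Γ_ℚ`-stable line carries an isogeny character `r` with
`r(φ_ℓ)² − a_ℓ r(φ_ℓ) + ℓ = 0` in `𝔽_p`; Mazur 1978 Prop. 6.3 (1)). The point counts `#Ẽ(𝔽_ℓ)`
(`ℓ ∈ {3, 7, 11, 13}`, the least witness of V16.json) are KERNEL-DECIDED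
(`natCard_point_eq_one_add_card` + `card_sol_eq_sum_euler` + `decide`), as are `ℓ ∤ Δ(E₀)` and the
root-freeness checks mod `5`; a third implementation (this seat's pure-python driver) recomputed every
`#Ẽ(𝔽_ℓ)` before typing. GLOBAL MINIMALITY of Cremona's reduced model is decided in the kernel from the
SUPPORT of `Δ` by x11c's per-prime test (`X11b.isGloballyMinimal_of_krausCriterion_support`,
`X11b/KrausMinimalityGeneralTwo.lean`; packaged as the Bool check `minSupportCheck` = trial-division
primality of the listed primes + `|Δ| = ∏ q^{v_q Δ}` + `X11b.minCheckAt` at each `q`: Silverman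
`q¹² ∤ Δ ∨ q⁴ ∤ c₄` (AEC VII.1 Rem. 1.1), or the integer Kraus test at `q = 2`, or `3⁸ ‖ c₆` at `q = 3`),
so every record is HYPOTHESIS-FREE (over the 17: Silverman settles every bad prime of 15 models;
`11552j1` needs Kraus at `2`, `16200j1` needs `3⁸ ‖ c₆`).

| pair | Cremona minimal model `[a₁,a₂,a₃,a₄,a₆]` | census family | image at `5` | `r` | witness | `#Ẽ(𝔽_ℓ)` | `a_ℓ` | minimality at the bad primes |
|---|---|---|---|---|---|---|---|---|
| `8092a1 @5` | `[0, 1, 0, -1030092, 376286852]` | X9 | `5S4` | 0 | `ℓ = 11` | `8` | `4` | Silverman |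
| `8100e1 @5` | `[0, 0, 0, -975, 11750]` | X4 (O8) | `3B/5S4` | 0 | `ℓ = 11` | `6` | `6` | Silverman |
| `8100f1 @5` | `[0, 0, 0, 225, -2250]` | X4 (O8) | `3B/5S4` | 0 | `ℓ = 11` | `18` | `-6` | Silverman |
| `11552j1 @5` | `[0, 0, 0, -20216, 33252432]` | X9 | `5Ns` | 0 | `ℓ = 3` | `4` | `0` | Kraus at `2` |

Every `X² − a_ℓX + ℓ` above is root-free mod `5` (kernel-decided below). NOT in these files: the 18th
V16 row `2450d1 @7` and the O8 rows `2450ba1 / 2450bd1 @7` (image `7Ns.3.1`: every good Frobenius has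
an `𝔽₇`-rational eigenvalue, so no Frobenius witness exists — sha-2 GEN 15; `irr(7)` there needs the
isogeny-character argument itself). Result: **`Irr W 5` with NO hypothesis for each pair of this part**;
the irreducibility input of the Matar–Nekovář consumer is then a kernel theorem BY NAME
(`hirr := irr_cremona…`). Nothing else about these pairs is asserted: the Heegner-index certificate,
`#Ш_an`, `r_an ≤ 1` and GZK remain that consumer's other binders, discharged (or not) by the census,
never by this file.

Data sources: a-invariants and conductors = Cremona's `allcurves` table as copied into `V16.json`
(`minimal_model_ainvs`, `N`); `(q, v_q N, v_q Δ)` recomputed by this seat; witnesses = `V16.json`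
(`witness_impl1` = `impl2_least_witness_independent`). References: B. Mazur, Invent. Math. 44 (1978)
§5, Prop. 6.3 (1) [Mazur1978]; J. E. Cremona, *Algorithms for Modular Elliptic Curves* (1997), Table 1
[Cremona1997]; J. H. Silverman, *AEC* (2009) VII.1 Rem. 1.1, VIII.8 [SilvermanAEC2009]; A. Kraus,
Manuscripta Math. 65 (1989) Prop. 1, Prop. 2 [Kraus1989]; A. Matar, J. Nekovář, JTNB 31 (2019)
Thm. 6.7 (1) [MatarNekovar2019] (consumer only; not used here).
-/

set_option autoImplicit false

noncomputable section

open scoped Classical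

open WeierstrassCurve Literature.NumberTheory.EllipticCurves
  Literature.NumberTheory.EllipticCurves.Rank1Residual
  Literature.NumberTheory.EllipticCurves.Rank1Residual.X11RankOneCertificates
  Summit.BirchSwinnertonDyer.BirchSwinnertonDyer.Rank1Residual

namespace Summit.BirchSwinnertonDyer.Rank1Residual.GaloisImage.SmallImageRecords

/-- `5` is prime. -/
instance factPrimeFiveB : Fact (Nat.Prime 5) := ⟨by norm_num⟩

/-- `7` is prime (Frobenius witness prime). -/
instance factPrimeSevenB : Fact (Nat.Prime 7) := ⟨by norm_num⟩

/-- `11` is prime (Frobenius witness prime). -/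
instance factPrimeElevenB : Fact (Nat.Prime 11) := ⟨by norm_num⟩

/-- `13` is prime (Frobenius witness prime). -/
instance factPrimeThirteenB : Fact (Nat.Prime 13) := ⟨by norm_num⟩

/-! ## §0 Two generic helpers for a literal integer model over `ℚ` (private; repeated in each part) -/

/-- An integer Weierstrass model with `Δ ≠ 0` is an elliptic curve over `ℚ` (`Δ` is the tree-rechecked
integer `discOf` of `X11RankOneCertificates/Schema.lean`). [cite: SilvermanAEC2009, III.1 (p. 42)] -/
private theorem isElliptic_of_discOf_ne_zeroB (a1 a2 a3 a4 a6 : ℤ)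
    (h : discOf [a1, a2, a3, a4, a6] ≠ 0) : (⟨a1, a2, a3, a4, a6⟩ : WeierstrassCurve ℚ).IsElliptic := by
  refine ⟨?_⟩
  have hΔ : (⟨a1, a2, a3, a4, a6⟩ : WeierstrassCurve ℚ).Δ = ((discOf [a1, a2, a3, a4, a6] : ℤ) : ℚ) := by
    simp only [WeierstrassCurve.Δ, WeierstrassCurve.b₂, WeierstrassCurve.b₄, WeierstrassCurve.b₆,
      WeierstrassCurve.b₈, discOf, invariants]
    push_cast
    ring
  rw [hΔ, isUnit_iff_ne_zero]
  exact_mod_cast h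

/-- The support-based minimality test evaluated per record: every listed `q` is prime (trial division
below `710²`), `|Δ(a)| = ∏ q^{v_q Δ}` over the list, and x11c's per-prime test `X11b.minCheckAt`
(Silverman `q¹² ∤ Δ ∨ q⁴ ∤ c₄`, or the integer Kraus test at `q = 2`, or `3⁸ ‖ c₆` at `q = 3`). Entries
`(q, v_q N, v_q Δ)`; `v_q N` is documentation. [folklore] -/
private def minSupportCheckB (a : List ℤ) (bad : List (ℕ × ℕ × ℕ)) : Bool :=
  bad.all (fun t => isPrimeBelow504100 t.1) &&
  (((bad.map fun t => t.1 ^ t.2.2).prod : ℕ) == (discOf a).natAbs) &&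
  bad.all (X11b.minCheckAt a)

/-- Global minimality of a literal integer model from a passing `minSupportCheckB` (soundness = x11c's
`X11b.isGloballyMinimal_of_krausCriterion_support`; unpacking as in `X11b.isGloballyMinimal_of_minCheck`).
[cite: SilvermanAEC2009, VII.1 Remark 1.1 and VIII.8] [cite: Kraus1989, Prop. 1 and Prop. 2] -/
private theorem isGloballyMinimal_of_minSupportCheckB (a1 a2 a3 a4 a6 : ℤ) (bad : List (ℕ × ℕ × ℕ))
    (h : minSupportCheckB [a1, a2, a3, a4, a6] bad = true) :
    (⟨a1, a2, a3, a4, a6⟩ : WeierstrassCurve ℚ).IsGloballyMinimal := by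
  simp only [minSupportCheckB, Bool.and_eq_true, List.all_eq_true, beq_iff_eq] at h
  obtain ⟨⟨hpr, hprod⟩, hmin⟩ := h
  refine X11b.isGloballyMinimal_of_krausCriterion_support a1 a2 a3 a4 a6 bad
    (fun t ht ↦ prime_of_isPrimeBelow504100 (hpr t ht)) hprod.symm fun t ht ↦ ?_
  have hmt := hmin t ht
  simp only [X11b.minCheckAt, Bool.or_eq_true, Bool.and_eq_true, decide_eq_true_eq, beq_iff_eq] at hmt
  rcases hmt with ((h12 | h4) | ⟨⟨⟨h2, h16⟩, h64⟩, hk⟩) | ⟨⟨h3, h8⟩, h9⟩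
  · exact Or.inl (Or.inl h12)
  · exact Or.inl (Or.inr h4)
  · exact Or.inr (Or.inl ⟨h2, h16, h64, hk⟩)
  · exact Or.inr (Or.inr ⟨h3, h8, h9⟩)

/-! ## §1 `8092a1 @ 5` (image `5S4`, census family X9, `r = 0`) -/

/-- `#Ẽ(𝔽_{11}) = 8` for `[0, 1, 0, -1030092, 376286852]` (`a_{11} = 4`). Kernel-decided. [folklore] -/
theorem card_8092a1_mod11 :
    Nat.card (((⟨0, 1, 0, -1030092, 376286852⟩ : WeierstrassCurve ℤ).map
      (Int.castRingHom (ZMod 11))).toAffine.Point) = 8 := by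
  rw [@WeierstrassCurve.natCard_point_eq_one_add_card (ZMod 11) (@ZMod.instField 11 ⟨by norm_num⟩)
    _ _ _ (by decide +kernel), @card_sol_eq_sum_euler (ZMod 11) (@ZMod.instField 11 ⟨by norm_num⟩)
    _ _ (by rw [ZMod.ringChar_zmod_n]; decide), ZMod.card]
  decide +kernel

/-- Cremona `8092a1`: `[0, 1, 0, -1030092, 376286852]` (`N = 8092`; good reduction at `5`, small image; V16 row `8092a1@5`). [cite: Cremona1997, Table 1 (curve 8092a1)] -/
def cremona8092a1 : WeierstrassCurve ℚ := ⟨0, 1, 0, -1030092, 376286852⟩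

/-- `8092a1` is an elliptic curve (`Δ = 8673999228120663808 ≠ 0`). -/
instance isElliptic_cremona8092a1 : cremona8092a1.IsElliptic := by
  have h := isElliptic_of_discOf_ne_zeroB 0 1 0 (-1030092) 376286852 (by decide)
  norm_num at h
  exact h

/-- `[0, 1, 0, -1030092, 376286852]` is globally minimal, kernel-decided from the support `(q, v_q N, v_q Δ) = [(2, 2, 8), (7, 1, 5), (17, 2, 10)]` of
`Δ = 8673999228120663808` (`c₄ = 49444432`, `c₆ = -325408506688`): Silverman at every bad prime.
[cite: SilvermanAEC2009, VII.1 Remark 1.1 and VIII.8] [cite: Kraus1989, Prop. 1 and Prop. 2] -/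
instance isGloballyMinimal_cremona8092a1 : cremona8092a1.IsGloballyMinimal := by
  have h := isGloballyMinimal_of_minSupportCheckB 0 1 0 (-1030092) 376286852 [(2, 2, 8), (7, 1, 5), (17, 2, 10)] (by decide +kernel)
  norm_num at h
  exact h

/-- The integral model of `8092a1` is `[0, 1, 0, -1030092, 376286852]`. [folklore] -/
theorem integralModelInt_cremona8092a1 : integralModelInt cremona8092a1 = ⟨0, 1, 0, -1030092, 376286852⟩ :=
  IntModel.integralModelInt_eq_of_map_eq _ (by ext <;> simp [WeierstrassCurve.map, cremona8092a1])

/-- **RECORD `8092a1 @ 5`: `E[5]` is irreducible — Frobenius certificate at `ℓ = 11` (`#Ẽ(𝔽_{11}) = 8`,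
`a_{11} = 4`; `X² − 4X + 11` root-free mod `5`), kernel-decided, NO hypothesis.**
[cite: Mazur1978, §5 (p. 148) and §6 Prop. 6.3 (1) (p. 153)] -/
theorem irr_cremona8092a1 : Irr cremona8092a1 5 :=
  IntModel.hasIrreducibleModPGaloisRep_of_intModel_of_noroot integralModelInt_cremona8092a1 5 11
    (by norm_num) (by decide) card_8092a1_mod11 (by decide)

/-! ## §2 `8100e1 @ 5` (image `3B/5S4`, census family X4, `r = 0`) -/

/-- `#Ẽ(𝔽_{11}) = 6` for `[0, 0, 0, -975, 11750]` (`a_{11} = 6`). Kernel-decided. [folklore] -/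
theorem card_8100e1_mod11 :
    Nat.card (((⟨0, 0, 0, -975, 11750⟩ : WeierstrassCurve ℤ).map
      (Int.castRingHom (ZMod 11))).toAffine.Point) = 6 := by
  rw [@WeierstrassCurve.natCard_point_eq_one_add_card (ZMod 11) (@ZMod.instField 11 ⟨by norm_num⟩)
    _ _ _ (by decide +kernel), @card_sol_eq_sum_euler (ZMod 11) (@ZMod.instField 11 ⟨by norm_num⟩)
    _ _ (by rw [ZMod.ringChar_zmod_n]; decide), ZMod.card]
  decide +kernel

/-- Cremona `8100e1`: `[0, 0, 0, -975, 11750]` (`N = 8100`; additive at `5`; an O8 pair (additive at `5`, non-surjective image); V16 row `8100e1@5`). [cite: Cremona1997, Table 1 (curve 8100e1)] -/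
def cremona8100e1 : WeierstrassCurve ℚ := ⟨0, 0, 0, -975, 11750⟩

/-- `8100e1` is an elliptic curve (`Δ = -324000000 ≠ 0`). -/
instance isElliptic_cremona8100e1 : cremona8100e1.IsElliptic := by
  have h := isElliptic_of_discOf_ne_zeroB 0 0 0 (-975) 11750 (by decide)
  norm_num at h
  exact h

/-- `[0, 0, 0, -975, 11750]` is globally minimal, kernel-decided from the support `(q, v_q N, v_q Δ) = [(2, 2, 8), (3, 4, 4), (5, 2, 6)]` of
`Δ = -324000000` (`c₄ = 46800`, `c₆ = -10152000`): Silverman at every bad prime.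
[cite: SilvermanAEC2009, VII.1 Remark 1.1 and VIII.8] [cite: Kraus1989, Prop. 1 and Prop. 2] -/
instance isGloballyMinimal_cremona8100e1 : cremona8100e1.IsGloballyMinimal := by
  have h := isGloballyMinimal_of_minSupportCheckB 0 0 0 (-975) 11750 [(2, 2, 8), (3, 4, 4), (5, 2, 6)] (by decide +kernel)
  norm_num at h
  exact h

/-- The integral model of `8100e1` is `[0, 0, 0, -975, 11750]`. [folklore] -/
theorem integralModelInt_cremona8100e1 : integralModelInt cremona8100e1 = ⟨0, 0, 0, -975, 11750⟩ :=
  IntModel.integralModelInt_eq_of_map_eq _ (by ext <;> simp [WeierstrassCurve.map, cremona8100e1])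

/-- **RECORD `8100e1 @ 5`: `E[5]` is irreducible — Frobenius certificate at `ℓ = 11` (`#Ẽ(𝔽_{11}) = 6`,
`a_{11} = 6`; `X² − 6X + 11` root-free mod `5`), kernel-decided, NO hypothesis.**
[cite: Mazur1978, §5 (p. 148) and §6 Prop. 6.3 (1) (p. 153)] -/
theorem irr_cremona8100e1 : Irr cremona8100e1 5 :=
  IntModel.hasIrreducibleModPGaloisRep_of_intModel_of_noroot integralModelInt_cremona8100e1 5 11
    (by norm_num) (by decide) card_8100e1_mod11 (by decide)

/-! ## §3 `8100f1 @ 5` (image `3B/5S4`, census family X4, `r = 0`) -/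

/-- `#Ẽ(𝔽_{11}) = 18` for `[0, 0, 0, 225, -2250]` (`a_{11} = -6`). Kernel-decided. [folklore] -/
theorem card_8100f1_mod11 :
    Nat.card (((⟨0, 0, 0, 225, -2250⟩ : WeierstrassCurve ℤ).map
      (Int.castRingHom (ZMod 11))).toAffine.Point) = 18 := by
  rw [@WeierstrassCurve.natCard_point_eq_one_add_card (ZMod 11) (@ZMod.instField 11 ⟨by norm_num⟩)
    _ _ _ (by decide +kernel), @card_sol_eq_sum_euler (ZMod 11) (@ZMod.instField 11 ⟨by norm_num⟩)
    _ _ (by rw [ZMod.ringChar_zmod_n]; decide), ZMod.card]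
  decide +kernel

/-- Cremona `8100f1`: `[0, 0, 0, 225, -2250]` (`N = 8100`; additive at `5`; an O8 pair (additive at `5`, non-surjective image); V16 row `8100f1@5`). [cite: Cremona1997, Table 1 (curve 8100f1)] -/
def cremona8100f1 : WeierstrassCurve ℚ := ⟨0, 0, 0, 225, -2250⟩

/-- `8100f1` is an elliptic curve (`Δ = -2916000000 ≠ 0`). -/
instance isElliptic_cremona8100f1 : cremona8100f1.IsElliptic := by
  have h := isElliptic_of_discOf_ne_zeroB 0 0 0 225 (-2250) (by decide)
  norm_num at h
  exact h

/-- `[0, 0, 0, 225, -2250]` is globally minimal, kernel-decided from the support `(q, v_q N, v_q Δ) = [(2, 2, 8), (3, 4, 6), (5, 2, 6)]` of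
`Δ = -2916000000` (`c₄ = -10800`, `c₆ = 1944000`): Silverman at every bad prime.
[cite: SilvermanAEC2009, VII.1 Remark 1.1 and VIII.8] [cite: Kraus1989, Prop. 1 and Prop. 2] -/
instance isGloballyMinimal_cremona8100f1 : cremona8100f1.IsGloballyMinimal := by
  have h := isGloballyMinimal_of_minSupportCheckB 0 0 0 225 (-2250) [(2, 2, 8), (3, 4, 6), (5, 2, 6)] (by decide +kernel)
  norm_num at h
  exact h

/-- The integral model of `8100f1` is `[0, 0, 0, 225, -2250]`. [folklore] -/
theorem integralModelInt_cremona8100f1 : integralModelInt cremona8100f1 = ⟨0, 0, 0, 225, -2250⟩ :=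
  IntModel.integralModelInt_eq_of_map_eq _ (by ext <;> simp [WeierstrassCurve.map, cremona8100f1])

/-- **RECORD `8100f1 @ 5`: `E[5]` is irreducible — Frobenius certificate at `ℓ = 11` (`#Ẽ(𝔽_{11}) = 18`,
`a_{11} = -6`; `X² + 6X + 11` root-free mod `5`), kernel-decided, NO hypothesis.**
[cite: Mazur1978, §5 (p. 148) and §6 Prop. 6.3 (1) (p. 153)] -/
theorem irr_cremona8100f1 : Irr cremona8100f1 5 :=
  IntModel.hasIrreducibleModPGaloisRep_of_intModel_of_noroot integralModelInt_cremona8100f1 5 11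
    (by norm_num) (by decide) card_8100f1_mod11 (by decide)

/-! ## §4 `11552j1 @ 5` (image `5Ns`, census family X9, `r = 0`) -/

/-- `#Ẽ(𝔽_{3}) = 4` for `[0, 0, 0, -20216, 33252432]` (`a_{3} = 0`). Kernel-decided. [folklore] -/
theorem card_11552j1_mod3 :
    Nat.card (((⟨0, 0, 0, -20216, 33252432⟩ : WeierstrassCurve ℤ).map
      (Int.castRingHom (ZMod 3))).toAffine.Point) = 4 := by
  rw [@WeierstrassCurve.natCard_point_eq_one_add_card (ZMod 3) (@ZMod.instField 3 ⟨by norm_num⟩)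
    _ _ _ (by decide +kernel), @card_sol_eq_sum_euler (ZMod 3) (@ZMod.instField 3 ⟨by norm_num⟩)
    _ _ (by rw [ZMod.ringChar_zmod_n]; decide), ZMod.card]
  decide +kernel

/-- Cremona `11552j1`: `[0, 0, 0, -20216, 33252432]` (`N = 11552`; good reduction at `5`, small image; V16 row `11552j1@5`). [cite: Cremona1997, Table 1 (curve 11552j1)] -/
def cremona11552j1 : WeierstrassCurve ℚ := ⟨0, 0, 0, -20216, 33252432⟩

/-- `11552j1` is an elliptic curve (`Δ = -477144100447105024 ≠ 0`). -/
instance isElliptic_cremona11552j1 : cremona11552j1.IsElliptic := by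
  have h := isElliptic_of_discOf_ne_zeroB 0 0 0 (-20216) 33252432 (by decide)
  norm_num at h
  exact h

/-- `[0, 0, 0, -20216, 33252432]` is globally minimal, kernel-decided from the support `(q, v_q N, v_q Δ) = [(2, 5, 12), (19, 2, 11)]` of
`Δ = -477144100447105024` (`c₄ = 970368`, `c₆ = -28730101248`): the integer Kraus test at `2`, Silverman elsewhere.
[cite: SilvermanAEC2009, VII.1 Remark 1.1 and VIII.8] [cite: Kraus1989, Prop. 1 and Prop. 2] -/
instance isGloballyMinimal_cremona11552j1 : cremona11552j1.IsGloballyMinimal := by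
  have h := isGloballyMinimal_of_minSupportCheckB 0 0 0 (-20216) 33252432 [(2, 5, 12), (19, 2, 11)] (by decide +kernel)
  norm_num at h
  exact h

/-- The integral model of `11552j1` is `[0, 0, 0, -20216, 33252432]`. [folklore] -/
theorem integralModelInt_cremona11552j1 : integralModelInt cremona11552j1 = ⟨0, 0, 0, -20216, 33252432⟩ :=
  IntModel.integralModelInt_eq_of_map_eq _ (by ext <;> simp [WeierstrassCurve.map, cremona11552j1])

/-- **RECORD `11552j1 @ 5`: `E[5]` is irreducible — Frobenius certificate at `ℓ = 3` (`#Ẽ(𝔽_{3}) = 4`,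
`a_{3} = 0`; `X² + 3` root-free mod `5`), kernel-decided, NO hypothesis.**
[cite: Mazur1978, §5 (p. 148) and §6 Prop. 6.3 (1) (p. 153)] -/
theorem irr_cremona11552j1 : Irr cremona11552j1 5 :=
  IntModel.hasIrreducibleModPGaloisRep_of_intModel_of_noroot integralModelInt_cremona11552j1 5 3
    (by norm_num) (by decide) card_11552j1_mod3 (by decide)

/-! ## §5 Summary of part B -/

/-- **Part B: `irr(5)` in the kernel, NO hypothesis, for `8092a1`, `8100e1`, `8100f1`, `11552j1`.** Per-pair records; nothing
booked; no class statement. [cite: Mazur1978, §6 Prop. 6.3 (1) (p. 153)] -/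
theorem irr_five_frobenius_recordsB :
    Irr cremona8092a1 5 ∧
    Irr cremona8100e1 5 ∧
    Irr cremona8100f1 5 ∧
    Irr cremona11552j1 5 :=
  ⟨irr_cremona8092a1, irr_cremona8100e1, irr_cremona8100f1, irr_cremona11552j1⟩

end Summit.BirchSwinnertonDyer.Rank1Residual.GaloisImage.SmallImageRecords

end
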